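import Literature.NumberTheory.EllipticCurves.EtaQuotientQExpansionProofs
import HarnessLib

/-!
# Route `EisensteinDepletionAtTwo`, crux `StarGO2Sigma` (stmt-BirchSwinnertonDyer-27046), line `kummer` —
# DEFINITIONS of the eta–Kummer square law (★η): the divisor set `T(N)` and the theta series `Θ_N`

Lead bsd-rank2-star-p1 GEN 13 (kummer skeleton v7).  DEFINITIONS ONLY (two `def`s and `rfl`/`simp` unfoldings; no
named fact, no `sorry`).  These are the objects posited by planner bsd-rank2-p2 GEN 36's memo K-ETA.md (HOME
run/shared/lean/pub/bsd-rank2/p2/g36/; typed sketch `KEtaLaw.lean`, `kEtaDivisors` / `thetaN`), re-typed over the TREE's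
integer Euler products `formalEulerScaled t = ∏_{n ≥ 1} (1 − q^{tn}) ∈ ℤ⟦q⟧`
(`Literature/NumberTheory/EllipticCurves/EtaQuotientQExpansionProofs.lean`) so that they match the `q`-expansions of
`η`-quotients (`qExpansion_eulerFn`, `etaQuotient_eq_prod_eulerFn_zpow`) by name:

* `kummerThetaDivisors N = T(N) := {t ∣ N : v_ℓ(t) ≠ 1 for every prime ℓ with ℓ² ∣ N}` — all divisors of a
  squarefree `N`; `∏_{ℓ ∥ N} {1, ℓ} × ∏_{ℓ² ∥ N} {1, ℓ²}` when every exponent is `≤ 2`.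
* `kummerThetaSeries N = Θ_N(q) := ∏_{t ∈ T(N)} ∏_{n ≥ 1} (1 − q^{tn}) ∈ 1 + qℤ⟦q⟧`.

They enter the registered stubs of line `kummer` v7 (`stub_etaSqrt`: the square root of the Eisenstein `η`-quotient has
`q`-expansion `≡ Θ_N` modulo unit squares; `stub_etaKummerTheta`: `Θ_N · c²q²(x([c]M) − x₀)` is the square of an
integral series, the (★η) law from THEOREM K, `…StarGO2KEta*`).  HONEST FRAMING: vocabulary only; nothing here proves
anything about the crux, nothing reads an analytic rank; `StarGO2Sigma` / E1M / BSD are NOT proved by this file.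

References: planner memo K-ETA.md §0–§1 (cell bsd-rank2, 2026-08-28); T. M. Apostol, *Modular Functions and
Dirichlet Series in Number Theory*, GTM 41, §3.1–3.2 (`η` and Euler's product) [Apostol1990]; G. Köhler, *Eta products
and theta series identities* (2011), §1.1, §2.1.
-/

set_option autoImplicit false

noncomputable section

open PowerSeries Literature.NumberTheory.EllipticCurves.ModularForms

namespace Summit.BirchSwinnertonDyer.BirchSwinnertonDyer.Theorems.DepletionAtTwo

/-- **The theta divisor set `T(N)`** of the eta–Kummer square law (K-ETA §0): the divisors `t ∣ N` with
`v_ℓ(t) ≠ 1` at every prime `ℓ` with `ℓ² ∣ N` — all divisors when `N` is squarefree, and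
`∏_{ℓ ∥ N} {1, ℓ} × ∏_{ℓ² ∥ N} {1, ℓ²}` when every exponent of `N` is `≤ 2`.  These are exactly the divisors `t`
whose stabilisation coefficient `c_t` (`stabCoeff N β t`) is a `2`-adic unit. [cite: Apostol1990, §3.1–3.2] -/
def kummerThetaDivisors (N : ℕ) : Finset ℕ :=
  N.divisors.filter fun t ↦ ∀ ℓ ∈ N.primeFactors, 2 ≤ N.factorization ℓ → t.factorization ℓ ≠ 1

/-- **The theta series `Θ_N(q) = ∏_{t ∈ T(N)} ∏_{n ≥ 1} (1 − q^{tn}) ∈ 1 + qℤ⟦q⟧`** of the eta–Kummer square law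
(K-ETA §0), as an integer formal power series: the product over `T(N)` of the tree's `formalEulerScaled t`
(`= ∏_{n≥1}(1 − q^{tn})`, the `q`-series of `eulerFn t`, `hasSum_eulerFn`). [cite: Apostol1990, §3.1–3.2] -/
def kummerThetaSeries (N : ℕ) : PowerSeries ℤ :=
  ∏ t ∈ kummerThetaDivisors N, formalEulerScaled t

/-! ## Unfolding lemmas -/

/-- Membership in `T(N)` unfolded. [cite: Apostol1990, §3.1–3.2 (unfolding)] -/
theorem mem_kummerThetaDivisors {N t : ℕ} :
    t ∈ kummerThetaDivisors N ↔
      t ∈ N.divisors ∧ ∀ ℓ ∈ N.primeFactors, 2 ≤ N.factorization ℓ → t.factorization ℓ ≠ 1 := by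
  unfold kummerThetaDivisors
  rw [Finset.mem_filter]

/-- `T(N) ⊆ divisors N`. [cite: Apostol1990, §3.1–3.2 (unfolding)] -/
theorem kummerThetaDivisors_subset (N : ℕ) : kummerThetaDivisors N ⊆ N.divisors :=
  Finset.filter_subset _ _

/-- `Θ_N` unfolded as the finite product of Euler products. [cite: Apostol1990, §3.1–3.2 (unfolding)] -/
theorem kummerThetaSeries_eq (N : ℕ) :
    kummerThetaSeries N = ∏ t ∈ kummerThetaDivisors N, formalEulerScaled t := rfl

/-- `Θ_N` has constant term `1`. [cite: Apostol1990, §3.1–3.2] -/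
theorem constantCoeff_kummerThetaSeries (N : ℕ) : constantCoeff (kummerThetaSeries N) = 1 := by
  rw [kummerThetaSeries, map_prod]
  exact Finset.prod_eq_one fun t _ ↦ constantCoeff_formalEulerScaled t

end Summit.BirchSwinnertonDyer.BirchSwinnertonDyer.Theorems.DepletionAtTwo

end
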